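import Mathlib
import HarnessLib
import HarnessLib.Audit
import Summits.AnomalousDissipation.Statement
import Literature.Analysis.FluidPDE.TorusClassicalLerayHopf
import Literature.Analysis.FluidPDE.TorusClassicalLerayHopfProofs
import Literature.Analysis.FunctionSpaces.TorusFourierCalculus
import Literature.Analysis.FluidPDE.ClassicalSolution
import Literature.ModelTheory.ExponentialFields.ModelTheoryPreds
import Literature.ModelTheory.ExponentialFields.Languages
import HarnessLib.Audit.Status.Attr

/-!
Route: TameDichotomy

DORMANT since 2026-08-22T05:28:19Z (reconciler: no traction for 5.1 d (last activity item-evidence-added at 2026-08-17T02:30:58Z); parked, not closed — `ledger route dormant route-AnomalousDissipation-TameDichotomy --off` to reactivate) — unstaffed, not closed; items shared with open routes are served there. `ledger route dormant <id> --off` reactivates.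

Route TameDichotomy — AnomalousDissipation (= Literature.Turb.ZerothLaw); realises idea card
tame-zeroth-law-ominimal-dichotomy ("No tame cascade").

## Thesis X (words)
It suffices to exhibit a TAME steady witness: a smooth steady divergence-free mean-zero force f on
T³, an o-minimal expansion L of the real ordered field (ℝ,<,+,·) (o-minimality is a HYPOTHESIS on L
— ℝ_an, ℝ_exp, ℝ_an,exp, the Pfaffian closure all qualify; in-tree predicate
FirstOrder.Language.IsOMinimal), and an L-DEFINABLE one-parameter family ν ↦ (u_ν, p_ν), ν ∈ (0,δ),
of classical STEADY Navier–Stokes states forced by f (the graph {(ν, y, u_ν(π y)) : ν ∈ (0,δ), y ∈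
[0,1)³} ⊆ ℝ⁷ is L-definable with parameters) with ∫|u_ν|² ≤ E and ν‖∇u_ν‖₂² ≥ ε > 0 for all ν ∈
(0,δ).

## Thesis X (Lean) = item TameSteadyWitness (elaborates, planner Sketch.lean rc 0)
∃ f, IsSmooth f ∧ IsDivFree f ∧ HasZeroMean f ∧ ∃ (L : Language) (_ : L.Structure ℝ) (φ :
Language.orderedRing →ᴸ L) (_ : φ.IsExpansionOn ℝ), L.IsOMinimal ℝ ∧ ∃ δ u p, 0 < δ ∧ univ.Definable
L {graph of u over (0,δ) × unit cube} ∧ (∀ ν ∈ Ioo 0 δ, Torus.IsClassicalNSSolutionOn univ ν (fun _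
=> f) (fun _ => u ν) (fun _ => p ν)) ∧ (∃ E, ∀ ν ∈ Ioo 0 δ, ∫ ‖u ν x‖² ≤ E) ∧ ∃ ε > 0, ∀ ν ∈ Ioo 0
δ, ε ≤ ν * Torus.gradNormSq (u ν).

## Assembly X → AnomalousDissipation (item Assembly)
(h : Literature.Analysis.FluidPDE.Torus.isGlobalLerayHopf_of_isClassicalNSSolutionOn) → X →
AnomalousDissipation: sample ν_j := δ/(j+2); u_j t := u ν_j (time-constant classical solution on ℝ ×
T³, hence global Leray–Hopf from u_j 0 by the LANDED bridge fact); meanEnergy of a time-constant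
field is ∫|u|² (Cesàro mean of a constant), meanDissipation ν_j u_j = ν_j (eGradNormSq (u
ν_j)).toReal = ν_j gradNormSq (u ν_j) by the PROVED Torus.gradNormSq_eq_toReal_eGradNormSq_holds.
Pure glue (≤ 150 lines). X also implies CoherentStates.SteadyZerothLaw (stmt-0219) verbatim by the
same sampling.

## The fork (why the route is called a dichotomy)
The ranked cruxes are the NO-GO side: NoTameCascade (rank 2) says X is impossible — for EVERY
o-minimal L, every definable bounded-energy steady family has ν‖∇u_ν‖² → 0 as ν → 0⁺ ("anomalous
steady families are never o-minimally definable": Kolmogorov's cascade needs infinitely many nested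
scales, as a theorem). Planner's honest prior: NoTameCascade is the theorem and X dies; a proof of
NoTameCascade closes X as refuted and enters `ledger negatives` as a new barrier shaping every
steady/skeleton witness programme (CoherentStates stmt-0219/0222, cards
codim-two-burgers-skeleton-log-ladder, frozen-non-sard-steady-witness, inverse-design-quiet-branch,
stokes-curve-reaches-zero-steady-variety): a finite blueprint (matched asymptotics in
exp/log/erf/restricted-analytic profiles, finitely many layers/tubes/points with monotone definable
widths) can never be a zeroth-law witness. If instead the census behind NoTameCascade is wrong, the
surviving tame object (a codimension-3 "strained dissipator", see StrainedLiouville) is a finitely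
described explicit witness and X → summit.

Rationale: WHY THIS LINE (model theory → turbulence, explicit dictionary). "Finitely many scales" has an exact
meaning: definability of the ν-family in an o-minimal expansion of (ℝ,<,+,·) [Dries1998 Ch.3:
Monotonicity (1.2) PDF p.60; Uniform Finiteness (2.13) p.67; families (3.6) p.76]. It buys,
uniformly in ν: (F) {|∇u_ν| > ν^{-a}} has ≤ M cells, M independent of ν; (H) every definable scalar
germ (widths, circulations, u_ν(x)) is eventually monotone. Dictionary: cascade depth ↦ number of
cells; intermittency exponents ↦ exponents of definable germs; Euler limit ↦ the POINTWISE limit ū =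
lim u_ν (exists by (H); smooth off a definable Σ, dim Σ ≤ 2) with the power identity ε_lim = lim
ν‖∇u_ν‖² = ∫ f·ū (item TameLimitPower). NoTameCascade = "tame steady Euler limits absorb no power":
∫ f·ū = lim_{r→0} Bernoulli flux of (|ū|²/2+p̄)ū into the r-neighbourhood of Σ; sheets absorb
nothing (Rankine–Hugoniot), lines/points need |ū| ≍ r^{-1/3} / r^{-2/3} local steady Euler states
with non-zero flux (homogeneous ones have none: Shvydkoy2015 = arXiv:1510.03378, arXiv:1409.4322;
cf. DeRosaDrivasInversi2024, arXiv:2412.08493), concentration defects are fought at NS level by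
blow-up in the local strain (StrainedLiouville). Every item elaborates over in-tree notions; no
unproved fact in the cone.
RANKED CRUXES. #2 NoTameCascade (the no-go, universal in L and f). #3 TameSteadyTwoHalfD
(x₃-invariant rung: planar part Alexakis–Doering ν^{1/2} [AlexakisDoering2006PLA]; the steady
passive third component is the arena for (F)+(H); the only autonomous scalar anomaly known,
JohanssonSorella2024 = arXiv:2409.03599 Thm 1.1/1.5, is a non-tame pipe fractal). #4
StrainedLiouville (steady finite-Dirichlet O(1/|y|) NS perturbations of a linear strain in ℝ³ are
trivial; A = 0 is the L^{9/2} Liouville theorem [Galdi2011 Ch. X; arXiv:1604.07643; Seregin2016;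
ChaeWolf2019]; A ≠ 0 is new and excludes the energetically consistent strained blobs of scale √ν,
amplitude ν^{-3/4}). #5 TameCascade (rev 4, route-choice repair: the POSITIVE horn, ∃-form of
¬NoTameCascade — a definable bounded-energy steady family whose dissipation does not → 0; prior
FALSE; a proof also needs an o-minimality theorem beyond the real field in tree, Wilkie1996 /
VandendriesMiller1994). #10 OMinimalMonotonicity (auto-crux; = Literature theorem
real_exists_gt_continuousOn_and_monotoneOn_or_antitoneOn). SUPPORT: TameLimitPower,
OMinimalUniformFiniteness, TameForkGlue (TameCascade → TameLimitPower → TameSteadyWitness; candidate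
proof attached, rc 0), Assembly.
KILL CRITERIA. NoTameCascade proved ⇒ TameCascade and X refuted ⇒ route closes
`refuted:TameSteadyWitness`, census = the barrier "anomaly ⇒ non-definability" (the intended
harvest). TameCascade proved ⇒ X (TameForkGlue) ⇒ summit (closes). StrainedLiouville refuted by an
explicit strained blob ⇒ the blob family becomes the positive programme (tenure split of
TameCascade).
NOT DECOMPOSED YET. The stratum-by-codimension split of NoTameCascade (sheets / lines / points /
concentration defects) waits for TameLimitPower; time-periodic tame states and ℝ_an,exp-specific
asymptotics (LE-series of ε(ν)) are left out; no third layer.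
CHEAPEST FALSIFIER. x₃-invariant forces with f₃ = 0: steady bounded-energy states dissipate ≤
Cν^{1/2} (Literature.Barriers.AnomalousDissipation.AlexakisDoering2006_energyDissipationBound) — no
witness of any kind there. In general, the UNIFORMLY BOUNDED sub-case sup_ν‖u_ν‖_∞ < ∞: the tame
limit ū is a bounded steady weak Euler state smooth off Σ (dim ≤ 2), and bounded weak solutions
carry no dissipation on sets of dimension < 3
(Literature.Barriers.AnomalousDissipation.DeRosaDrivasInversi2024_thm12_bounded); with
TameLimitPower this settles the bounded tame case and leaves exactly the unbounded-strata census.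
PRIOR-PROGRAMME NOTES: not read. Cross-summit: StrainedLiouville abuts NavierStokesRegularity's
Liouville items (SelfSimilarLiouville); Galdi's decay-free A = 0 problem is excluded by the O(1/|y|)
clause.

Novelty: Searched (2026-08-15, this planner; searchd/OpenAlex/arXiv APIs intermittently down, crossref +
zbMATH + galaxy + held texts used): crossref "o-minimal definable solutions Navier-Stokes Euler
fluid" (0 relevant /15), zbMATH "o-minimal partial differential equation definable solution" (0),
zbMATH "Kaiser Dirichlet o-minimal" → doi:10.1215/00127094-2009-012 (Kaiser 2009: Dirichlet problem
with semianalytic data is o-minimal — the ONLY PDE-definability precedent), zbMATH "o-minimal …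
Hardy field solutions" → arXiv:2012.06998 (Le Gal–Matusinski–Sanz: definable ODEs vs Hardy fields),
`lit galaxy search "o-minimal Navier-Stokes" --star all` (0 rows), crossref "anomalous dissipation
two-dimensional autonomous velocity field" → arXiv:2409.03599 = JohanssonSorella2024 (read pp.1–5:
Thm 1.1 autonomous C^α field with scalar anomaly via branching–merging pipes; Thm 1.5
time-independent ν-dependent forces for NS on T³), crossref "Liouville theorem stationary
Navier-Stokes linear strain Burgers" → Seregin2016 doi:10.1088/0951-7715/29/8/2191, ChaeWolf2019
doi:10.1007/s00526-019-1549-5, arXiv:1604.07643 (L^{9/2} Liouville and refinements; nothing with a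
strain background), held book doi:10.1017/cbo9780511525919 = Dries1998 read at PDF pp.60, 67, 76;
plus the card's two refuter novelty audits (2026-08-15: grade new-combination; nearest prior
doi:10.1090/s0894-0347-03-00427-2 Rolin–Speissegger–Wilkie, arXiv:2301.09603 / arXiv:2412.08493 De
Rosa–Drivas–Inversi, doi:10.1007/s00021-008-0290-1 Šve  [refs: 10.1215/00127094-2009-012, 10.1088/0951-7715/29/8/2191, 10.1007/s00526-019-1549-5, 10.1017/cbo9780511525919, 10.1090/s0894-0347-03-00427-2, 10.1007/s00021-008-0290-1, 2012.06998, 2409.03599, 1604.07643, 2301.09603, 2412.08493, 1510.03378, 1409.4322, doi:10.1215/00127094-2009-012, doi:10.1088/0951-7715/29/8/2191, doi:10.1007/s00526-019-1549-5, doi:10.1017/cbo9780511525919, doi:10.1090/s0894-0347-03]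

Barriers (technique_class: o-minimal-tameness steady-branches codim-accounting): technique_class: o-minimal-tameness steady-branches codim-accounting
- Literature.Barriers.AnomalousDissipation.DeRosaDrivasInversi2024_thm12_bounded and
Literature.Barriers.AnomalousDissipation.DeRosaDrivasInversi2024_thm19_bounded: USED, not evaded —
bounded families cannot dissipate on sets of dimension < 3, so every power-absorbing tame stratum
must carry unbounded velocity (|ū| ≍ r^{-1/3} at lines, r^{-2/3} at points, or NS-scale
concentration); this is exactly the census NoTameCascade must close. The positive horn X (a tame
witness) would have to be unbounded near its strata, consistent with the barrier.
- Literature.Barriers.AnomalousDissipation.DeRosaIsett2024_thm213 and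
Literature.Barriers.AnomalousDissipation.DeRosaDrivasInversiIsett2025_cor51
(lower-dimensional-dissipation-support / intermittent witness families): consistent — a tame witness
would have closed Minkowski-thin dissipation support (finitely many definable strata) and hence
sub-K41 Besov blow-up; the barrier constrains the shape of X, it does not exclude it; NoTameCascade
claims the stronger statement that no such tame family exists at bounded energy.
- Literature.Barriers.AnomalousDissipation.AlexakisDoering2006_energyDissipationBound: is the planar
rung of TameSteadyTwoHalfD (used as input for the (u₁,u₂) part; the new content is the steady
passive third component).
- Literature.Barriers.AnomalousDissipation.DrivasElgindiIyerJeong2022_thm4 (Obukhov–Corrsin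
threshold, passive-scalar 2½-D): n/a in direc

History (route lifecycle, newest last):
- 2026-08-15T16:15:14Z · rev 3: restated Assembly (stmt-AnomalousDissipation-2857) — restate Assembly without the Literature-fact hypothesis (the fact is discharged and used inside closes); Assembly := TameSteadyWitness → AnomalousDissipation, i (planner-rbadge-AnomalousDissipation-TameDichot-f595e682-g2-0)
- 2026-08-16T02:17:41Z · AUTO-CRUX: 1 conjecture-grade item(s) promoted to crux (OMinimalMonotonicity) — refuter vetting / tiering apply (operator:999:1362873)
- 2026-08-16T03:42:03Z · AUTO-CRUX (backfill): TameSteadyWitness — hypotheses of the deciding theorem that nothing in the route derives are cruxes (operator:999:586464)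
- 2026-08-22T05:28:19Z · DORMANT — reconciler: no traction for 5.1 d (last activity item-evidence-added at 2026-08-17T02:30:58Z); parked, not closed — `ledger route dormant route-AnomalousDissipa (operator:999:2075192)

sub-problem: AnomalousDissipation · status: dormant · opened planner-plancard-AnomalousDissipation-Anomalo-8539b74d-0 2026-08-15T11:09:02Z · rev 5 · ledger route-AnomalousDissipation-TameDichotomy
GENERATED by the gate from the ledger (D-0016/17). Provers cite these decls: `theorem foo : Summit.AnomalousDissipation.AnomalousDissipation.Theses.TameDichotomy.<Decl> := …` in Summits/AnomalousDissipation/AnomalousDissipation/Theorems/<Name>.lean.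
-/

namespace Summit.AnomalousDissipation.AnomalousDissipation.Theses.TameDichotomy

open scoped BigOperators Topology Manifold Classical MeasureTheory ProbabilityTheory Matrix InnerProductSpace ComplexConjugate ContinuousMap
open Filter Set Function TopologicalSpace MeasureTheory

attribute [summit_statement] _root_.AnomalousDissipation

open Literature.Turb

/-- item stmt-AnomalousDissipation-2850 · crux (kind.auto-crux: conjecture-grade) · rank 0 · open · by planner
why it might fail: Planner's prior: FALSE — it is the positive horn of the fork; NoTameCascade (rank 2) is expected to be the theorem. A tame witness needs a codim-3 'strained dissipator' (scale √ν, amplitude ν^{-3/4}) that steady vortex stretching seems unable to confine.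
sources: Dries1998, DeRosaDrivasInversi2024, arXiv:2412.08493, Shvydkoy2015, Cheskidov2023, BrueDeLellis2023
[target] TAME STEADY WITNESS (thesis X of route TameDichotomy; idea card
tame-zeroth-law-ominimal-dichotomy, positive horn). Words: a smooth steady div-free mean-zero f on
T³, an o-minimal expansion L of (ℝ,<,+,·) (L.IsOMinimal ℝ is a hypothesis INSIDE the witness: ℝ_an,
ℝ_exp (Wilkie), ℝ_an,exp, Pfaffian closure all qualify), and an L-definable (with real parameters)
family ν ↦ (u_ν,p_ν), ν ∈ (0,δ), of classical steady NS_ν states forced by f — definability is asked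
of the graph {(ν,y,u_ν(proj y))} ⊆ ℝ⁷ over the unit cube (Torus.proj, FlatTorus.lean) — with ∫|u_ν|²
≤ E and ν·gradNormSq(u_ν) ≥ ε > 0 on (0,δ). Implies CoherentStates.SteadyZerothLaw
(stmt-AnomalousDissipation-0219) by sampling ν_j = δ/(j+2), and the summit via item Assembly.
Refuted by any proof of NoTameCascade (10-line corollary: instantiate L, f, δ, u, p; Tendsto → 0
contradicts ε ≤ ν gradNormSq on (0,δ)). Non-vacuity of the tameness clause: the drifting
Stokes-response family of CoherentStates 0221's note (f = sin(2πx₁)e₂, u = U e₁ + (a_ν cos 2πx₁ +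
b_ν sin 2πx₁)e₂, a_ν, b_ν rational in ν) is an ℝ_an-definable bounded-energy steady family reaching
ν → 0⁺ (laminar: ε ≍ ν). Sources: Dries1998 Ch.3 (1.2) PDF p.60, ( -/
@[route_item "route-AnomalousDissipation-TameDichotomy", crux]
def TameSteadyWitness : Prop :=
  ∃ f : UnitAddTorus (Fin 3) → EuclideanSpace ℝ (Fin 3), Literature.Analysis.FunctionSpaces.Torus.IsSmooth f ∧ Literature.Analysis.FunctionSpaces.Torus.IsDivFree f ∧ Literature.Analysis.FunctionSpaces.Torus.HasZeroMean f ∧ ∃ (L : FirstOrder.Language.{0, 0}) (_ : L.Structure ℝ) (φ : FirstOrder.Language.LHom Literature.ModelTheory.ExponentialFields.Language.orderedRing L) (_ : φ.IsExpansionOn ℝ), L.IsOMinimal ℝ ∧ ∃ (δ : ℝ) (u : ℝ → UnitAddTorus (Fin 3) → EuclideanSpace ℝ (Fin 3)) (p : ℝ → UnitAddTorus (Fin 3) → ℝ), 0 < δ ∧ (Set.univ : Set ℝ).Definable L {v : Fin 7 → ℝ | v 0 ∈ Set.Ioo 0 δ ∧ v 1 ∈ Set.Ico (0 : ℝ) 1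 ∧ v 2 ∈ Set.Ico (0 : ℝ) 1 ∧ v 3 ∈ Set.Ico (0 : ℝ) 1 ∧ v 4 = u (v 0) (Literature.Analysis.FunctionSpaces.Torus.proj !₂[v 1, v 2, v 3]) 0 ∧ v 5 = u (v 0) (Literature.Analysis.FunctionSpaces.Torus.proj !₂[v 1, v 2, v 3]) 1 ∧ v 6 = u (v 0) (Literature.Analysis.FunctionSpaces.Torus.proj !₂[v 1, v 2, v 3]) 2} ∧ (∀ ν ∈ Set.Ioo 0 δ, Literature.Analysis.FunctionSpaces.Torus.IsClassicalNSSolutionOn Set.univ ν (fun _ => f) (fun _ => u ν) (fun _ => p ν)) ∧ (∃ E : ℝ, ∀ ν ∈ Set.Ioo 0 δ, ∫ x, ‖u ν x‖ ^ 2 ≤ E) ∧ ∃ ε : ℝ, 0 < ε ∧ ∀ ν ∈ Set.Ioo 0 δ, ε ≤ ν * Literature.Analysis.FunctionSpaces.Torus.gradNormSq (u ν)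

/-- item stmt-AnomalousDissipation-2851 · crux · rank 2 · open · by planner
why it might fail: A definable codim-3 'strained blob' (scale √ν, amplitude ν^{-3/4}, fed O(1) power by O(1) strain) is energetically consistent, and tame strata with |ū|≍r^{-1/3} (lines) or r^{-2/3} (points) could carry non-zero Bernoulli flux; excluding them is vortex dynamics, not logic.
sources: Dries1998, book:dries1998-tame-topology-o-minimal-structures, DeRosaDrivasInversi2024, arXiv:2412.08493, Shvydkoy2015, arXiv:1409.4322
[crux] NO TAME CASCADE (TZL¬ of the card; the payload of the route). For EVERY first-order language
L with an L-structure on ℝ expanding the ordered ring (φ : Language.orderedRing →ᴸ L,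
φ.IsExpansionOn ℝ) that is o-minimal (FirstOrder.Language.IsOMinimal L ℝ, ModelTheoryPreds.lean),
every smooth div-free mean-zero f, every δ>0 and every L-definable family (u_ν,p_ν)_{ν∈(0,δ)} of
classical steady NS_ν(f) states with ∫|u_ν|² ≤ E: ν·gradNormSq(u_ν) → 0 as ν → 0⁺ (nhdsWithin 0 (Ioi
0)). LINE OF ATTACK (planner, see route rationale): (H) Monotonicity ⇒ ū(x) := lim u_ν(x) exists for
every x and is definable; steady energy identity ν‖∇u_ν‖² = ⟨f,u_ν⟩ + Vitali ⇒ ε_lim = ∫ f·ū (item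
TameLimitPower); (F) cell decomposition ⇒ ū smooth off a closed definable Σ, dim Σ ≤ 2, u_ν → ū in
C¹ on good cells, ν|∇u_ν|² → 0 there; hence ε_lim = lim_{r→0} Bernoulli flux of (|ū|²/2 + p̄)ū into
the r-neighbourhood of Σ (+ concentration defects); sheets absorb nothing (pillbox momentum balance
with faces in good cells: ū·n continuous, m[ū_τ] = 0, [p̄] = 0 ⇒ [H ū·n] = 0); lines/points need |ū|
≍ r^{-1/3}, r^{-2/3} rotational local steady Euler states with non-zero flux, homogeneous ones have
zero flux (points, -/
@[route_item "route-AnomalousDissipation-TameDichotomy"]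
def NoTameCascade : Prop :=
  ∀ (L : FirstOrder.Language.{0, 0}) [L.Structure ℝ] (φ : FirstOrder.Language.LHom Literature.ModelTheory.ExponentialFields.Language.orderedRing L) [φ.IsExpansionOn ℝ], L.IsOMinimal ℝ → ∀ f : UnitAddTorus (Fin 3) → EuclideanSpace ℝ (Fin 3), Literature.Analysis.FunctionSpaces.Torus.IsSmooth f → Literature.Analysis.FunctionSpaces.Torus.IsDivFree f → Literature.Analysis.FunctionSpaces.Torus.HasZeroMean f → ∀ (δ : ℝ) (u : ℝ → UnitAddTorus (Fin 3) → EuclideanSpace ℝ (Fin 3)) (p : ℝ → UnitAddTorus (Fin 3) → ℝ), 0 < δ → (Set.univ : Set ℝ).Definable L {v : Fin 7 → ℝ | v 0 ∈ Set.Ioo 0 δ ∧ v 1 ∈ Set.Ico (0 : ℝ) 1 ∧ v 2 ∈ Set.Ico (0 : ℝ) 1 ∧ v 3 ∈ Set.Ico (0 : ℝ) 1 ∧ v 4 = u (v 0) (Literature.Analysis.FunctionSpaces.Torus.proj !₂[v 1, v 2, v 3]) 0 ∧ v 5 = u (v 0) (Literature.Analysis.FunctionSpaces.Torus.proj !₂[v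 1, v 2, v 3]) 1 ∧ v 6 = u (v 0) (Literature.Analysis.FunctionSpaces.Torus.proj !₂[v 1, v 2, v 3]) 2} → (∀ ν ∈ Set.Ioo 0 δ, Literature.Analysis.FunctionSpaces.Torus.IsClassicalNSSolutionOn Set.univ ν (fun _ => f) (fun _ => u ν) (fun _ => p ν)) → (∃ E : ℝ, ∀ ν ∈ Set.Ioo 0 δ, ∫ x, ‖u ν x‖ ^ 2 ≤ E) → Filter.Tendsto (fun ν => ν * Literature.Analysis.FunctionSpaces.Torus.gradNormSq (u ν)) (nhdsWithin 0 (Set.Ioi 0)) (nhds 0)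

/-- item stmt-AnomalousDissipation-2852 · crux · rank 3 · open · by planner
why it might fail: Steady scalar layers at separatrices / critical levels of the planar cells could hold amplitude ν^{-1/4} in √ν-layers (bounded L², O(1) dissipation) if the source resonates along a streamline; autonomous 2-D fields DO give scalar anomaly when non-tame (JohanssonSorella2024 Thm 1.1).
sources: AlexakisDoering2006PLA, JohanssonSorella2024, arXiv:2409.03599, ConstantinTarfuleaVicol2013, doi:10.1017/s0022112006008639, Literature.Barriers.AnomalousDissipation.AlexakisDoering2006_energyDissipationBound
[crux] THE 2½-D RUNG: NoTameCascade restricted to x₃-invariant forces and states (invariance written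
as in Neg.TwohalfdNeg, stmt-AnomalousDissipation-0211: g (x + Pi.single 2 s) = g x). Then u_ν =
(v_ν(x₁,x₂), w_ν(x₁,x₂)): v_ν is a steady 2-D NS_ν state (its dissipation is ≤ C ν^{1/2} by the
enstrophy balance ν‖∇ω‖² = ⟨curl curl f, v⟩ ≤ ‖Δf‖√E and ‖ω‖² ≤ ‖v‖‖∇ω‖ — the Alexakis–Doering
bound, barrier decl AlexakisDoering2006_energyDissipationBound, steady case), and w_ν is a STEADY
passive scalar with steady source f₃: v_ν·∇w_ν = νΔw_ν + f₃, ∫w_ν² ≤ E, dissipation ν‖∇w_ν‖² =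
⟨f₃,w_ν⟩. Claim: → 0. Tame case analysis (finitely many cells UNIFORMLY in ν by (F); widths monotone
by (H)): Prandtl–Batchelor interiors of closed-streamline cells (bounded energy forces ∫∫_{ψ<c} f₃ =
0, else w ~ 1/ν), separatrix layers of width √ν (amplitude O(1) ⇒ dissipation √ν), critical levels
of shear-like cells (width (ν/kU′)^{1/3}, bounded energy caps the layer amplitude ⇒ dissipation ≲ E
ν^{1/3}(kU′)^{2/3}), hyperbolic corners (log corrections). The general (non-tame) steady statement
is open and is NOT filed here; the time-dependent x₃-invariant statement is Neg/TwoAndHalfD's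
TwohalfdNeg (0211). Auton -/
@[route_item "route-AnomalousDissipation-TameDichotomy"]
def TameSteadyTwoHalfD : Prop :=
  ∀ (L : FirstOrder.Language.{0, 0}) [L.Structure ℝ] (φ : FirstOrder.Language.LHom Literature.ModelTheory.ExponentialFields.Language.orderedRing L) [φ.IsExpansionOn ℝ], L.IsOMinimal ℝ → ∀ f : UnitAddTorus (Fin 3) → EuclideanSpace ℝ (Fin 3), (∀ (s : UnitAddCircle) (x : UnitAddTorus (Fin 3)), f (x + Pi.single (2 : Fin 3) s) = f x) → Literature.Analysis.FunctionSpaces.Torus.IsSmooth f → Literature.Analysis.FunctionSpaces.Torus.IsDivFree f → Literature.Analysis.FunctionSpaces.Torus.HasZeroMean f → ∀ (δ : ℝ) (u : ℝ → UnitAddTorus (Fin 3) → EuclideanSpace ℝ (Fin 3)) (p : ℝ → UnitAddTorus (Fin 3) → ℝ), 0 < δ → (∀ ν ∈ Set.Ioo 0 δ, ∀ (s : UnitAddCircle) (x : UnitAddTorus (Fin 3)), u ν (x + Pi.single (2 : Fin 3) s) = u ν x) → (Set.univ : Set ℝ).Definable L {v : Fin 7 → ℝ | v 0 ∈ Set.Ioo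 0 δ ∧ v 1 ∈ Set.Ico (0 : ℝ) 1 ∧ v 2 ∈ Set.Ico (0 : ℝ) 1 ∧ v 3 ∈ Set.Ico (0 : ℝ) 1 ∧ v 4 = u (v 0) (Literature.Analysis.FunctionSpaces.Torus.proj !₂[v 1, v 2, v 3]) 0 ∧ v 5 = u (v 0) (Literature.Analysis.FunctionSpaces.Torus.proj !₂[v 1, v 2, v 3]) 1 ∧ v 6 = u (v 0) (Literature.Analysis.FunctionSpaces.Torus.proj !₂[v 1, v 2, v 3]) 2} → (∀ ν ∈ Set.Ioo 0 δ, Literature.Analysis.FunctionSpaces.Torus.IsClassicalNSSolutionOn Set.univ ν (fun _ => f) (fun _ => u ν) (fun _ => p ν)) → (∃ E : ℝ, ∀ ν ∈ Set.Ioo 0 δ, ∫ x, ‖u ν x‖ ^ 2 ≤ E) → Filter.Tendsto (fun ν => ν * Literature.Analysis.FunctionSpaces.Torus.gradNormSq (u ν)) (nhdsWithin 0 (Set.Ioi 0)) (nhds 0)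

/-- item stmt-AnomalousDissipation-2853 · crux · rank 4 · open · by planner
why it might fail: Nothing is known for A ≠ 0: asymmetric strain carries Burgers sheets/tubes (excluded only by the decay clause), a fully localized steady state at large Reynolds number is not excluded by any known identity, and small |A| abuts Galdi's open Ḣ¹ Liouville problem.
sources: Galdi2011, arXiv:1604.07643, Seregin2016, ChaeWolf2019, KozonoTerasawaWakasugi2017, GallayWayne2006
[crux] STRAINED LIOUVILLE (terminal object of the card's codim-3 recursion, T3). For ν > 0, a
symmetric trace-free A (linear irrotational strain y ↦ Ay, itself a steady NS/Euler flow with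
pressure −|Ay|²/2), and a smooth steady perturbation v with (Ay + v) a classical steady NS solution
on ℝ³ with ZERO force (Literature.Analysis.FluidPDE.IsClassicalNSSolutionOn univ ν 0 (fun _ y => A y
+ v y) (fun _ => P)), decay sup ‖y‖‖v(y)‖ < ∞ and finite Dirichlet integral ∫‖∇v‖² < ∞ ⇒ v ≡ 0. A =
0: v ∈ L^{9/2}(ℝ³) (|v| ≲ 1/|y|, smooth) and ∇v ∈ L², so this is the classical L^{9/2} Liouville
theorem for D-solutions (Galdi2011 Ch. X; 'the well-known L^{9/2}(ℝ³) result', arXiv:1604.07643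
abstract; refinements Seregin2016, ChaeWolf2019, KozonoTerasawaWakasugi2017) — the decay clause
deliberately keeps Galdi's open Ḣ¹∩L⁶ problem (NavierStokesRegularity territory,
Literature.Analysis.FluidPDE.SelfSimilarLiouville) OUT. A ≠ 0 is new: Burgers vortices/sheets
(GallayWayne2006, GallayMaekawa2010, MoffattKidaOhkitani1994) are steady non-trivial states in
strain but do not decay along the stretching directions, so they are excluded by sup‖y‖‖v‖ < ∞ in
all directions; the statement says strain cannot confi -/
@[route_item "route-AnomalousDissipation-TameDichotomy"]
def StrainedLiouville : Prop :=
  ∀ (ν : ℝ) (A : EuclideanSpace ℝ (Fin 3) →L[ℝ] EuclideanSpace ℝ (Fin 3)) (v : EuclideanSpace ℝ (Fin 3) → EuclideanSpace ℝ (Fin 3)) (P : EuclideanSpace ℝ (Fin 3) → ℝ), 0 < ν → IsSelfAdjoint A → LinearMap.trace ℝ (EuclideanSpace ℝ (Fin 3)) (A : EuclideanSpace ℝ (Fin 3) →ₗ[ℝ] EuclideanSpace ℝ (Fin 3)) = 0 → Literature.Analysis.FluidPDE.IsClassicalNSSolutionOn Set.univ ν (fun _ _ => 0) (fun _ y =>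 A y + v y) (fun _ => P) → (∃ C : ℝ, ∀ y, ‖y‖ * ‖v y‖ ≤ C) → MeasureTheory.Integrable (fun y => ‖fderiv ℝ v y‖ ^ 2) → v = 0

/-- item stmt-AnomalousDissipation-14269 · crux · rank 5 · open · by planner
why it might fail: Planner's and both route reviewers' prior: FALSE — NoTameCascade (rank 2) should be the theorem: finitely many definable strata absorb no power (sheets: Rankine–Hugoniot; line/point states: zero flux; blobs: StrainedLiouville); the one autonomous anomaly known (JohanssonSorella2024) is non-tame.
sources: Dries1998, JohanssonSorella2024, arXiv:2409.03599, DeRosaDrivasInversi2024, arXiv:2412.08493, Shvydkoy2015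
[crux] TAME CASCADE — the positive horn of the fork, filed to make the target reachable
(route-choice repair 2026-08-16, hold `target-unreachable`). Classically equivalent to
¬NoTameCascade (planner Sketch.lean proves TameCascade ↔ ¬NoTameCascade and TameSteadyWitness →
TameCascade; lean check rc 0). Words: there exist a smooth steady divergence-free mean-zero f on T³,
an o-minimal expansion L of (ℝ,<,+,·) (φ : Language.orderedRing →ᴸ L, φ.IsExpansionOn ℝ,
L.IsOMinimal ℝ), δ > 0 and an L-definable (real parameters; graph over (0,δ) × unit cube exactly as
in TameSteadyWitness) family (u_ν, p_ν), ν ∈ (0,δ), of classical steady NS_ν(f) states with ∫|u_ν|²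
≤ E whose dissipation ν·gradNormSq(u_ν) does NOT tend to 0 as ν → 0⁺. It is as strong as the target
modulo the routine support TameLimitPower (see item TameForkGlue): the tame limit l = lim ν‖∇u_ν‖² =
∫ f·ū exists, l ≠ 0 forces l > 0, so ν‖∇u_ν‖² ≥ l/2 on some (0,δ′) and the restricted family IS a
TameSteadyWitness. Fork, now literal in the item graph: NoTameCascade proved ⇒ TameCascade and
TameSteadyWitness refuted (kill criterion; barrier 'anomaly ⇒ non-definability' harvested);
TameCascade proved ⇒ TameSteadyWitness (TameForkGlue) -/
@[route_item "route-AnomalousDissipation-TameDichotomy"]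
def TameCascade : Prop :=
  ∃ f : UnitAddTorus (Fin 3) → EuclideanSpace ℝ (Fin 3), Literature.Analysis.FunctionSpaces.Torus.IsSmooth f ∧ Literature.Analysis.FunctionSpaces.Torus.IsDivFree f ∧ Literature.Analysis.FunctionSpaces.Torus.HasZeroMean f ∧ ∃ (L : FirstOrder.Language.{0, 0}) (_ : L.Structure ℝ) (φ : FirstOrder.Language.LHom Literature.ModelTheory.ExponentialFields.Language.orderedRing L) (_ : φ.IsExpansionOn ℝ), L.IsOMinimal ℝ ∧ ∃ (δ : ℝ) (u : ℝ → UnitAddTorus (Fin 3) → EuclideanSpace ℝ (Fin 3)) (p : ℝ → UnitAddTorus (Fin 3) → ℝ), 0 < δ ∧ (Set.univ : Set ℝ).Definable L {v : Fin 7 → ℝ | v 0 ∈ Set.Ioo 0 δ ∧ v 1 ∈ Set.Ico (0 : ℝ) 1 ∧ v 2 ∈ Set.Ico (0 : ℝ) 1 ∧ v 3 ∈ Set.Ico (0 : ℝ) 1 ∧ v 4 = u (v 0) (Literature.Analysis.FunctionSpaces.Torus.proj !₂[v 1, v 2, v 3]) 0 ∧ v 5 = u (v 0) (Literature.Analysis.FunctionSpaces.Torus.proj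 !₂[v 1, v 2, v 3]) 1 ∧ v 6 = u (v 0) (Literature.Analysis.FunctionSpaces.Torus.proj !₂[v 1, v 2, v 3]) 2} ∧ (∀ ν ∈ Set.Ioo 0 δ, Literature.Analysis.FunctionSpaces.Torus.IsClassicalNSSolutionOn Set.univ ν (fun _ => f) (fun _ => u ν) (fun _ => p ν)) ∧ (∃ E : ℝ, ∀ ν ∈ Set.Ioo 0 δ, ∫ x, ‖u ν x‖ ^ 2 ≤ E) ∧ ¬ Filter.Tendsto (fun ν => ν * Literature.Analysis.FunctionSpaces.Torus.gradNormSq (u ν)) (nhdsWithin 0 (Set.Ioi 0)) (nhds 0)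

/-- item stmt-AnomalousDissipation-2855 · crux (kind.auto-crux: conjecture-grade) · rank 10 · open · by planner
why it might fail: auto-crux — conjecture-grade statement (docstring avows it ('ConjectureProofs')); it is open, so it may simply be false
sources: Dries1998, PillaySteinhorn1986
[support] MONOTONICITY THEOREM, germ form (input (H); KNOWN: van den Dries, Tame Topology Ch.3
(1.2), PDF p.60: a definable f : (a,b) → R is, on each of finitely many subintervals, constant or
strictly monotone and continuous; due to Pillay–Steinhorn 1986 for general o-minimal structures, PDF
p.77 notes). Filed over the in-tree predicate FirstOrder.Language.IsOMinimal
(ModelTheoryPreds.lean:249) for an expansion L of Language.orderedRing on ℝ (so < is definable): an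
L-definable g : ℝ → ℝ (graph definable with parameters) is continuous and monotone or antitone on
some (0,δ). Proof (~400 lines, elementary): vdD's Lemmas 1–3 p.60–62 use only o-minimality of
definable subsets of the line (finite unions of points/intervals:
Literature.ModelTheory.ExponentialFields.IsFiniteUnionOfIntervals) applied to sets defined from g
with <,+ available via φ; in-tree helpers:
Literature.ModelTheory.ExponentialFields.IsFiniteUnionOfIntervals.eventually_mem_or_eventually_notMem
(OMinimalExamples.lean:57), bddAbove_and_bddBelow_of_isOMinimal (LastRootConjectureProofs.lean:674),
definable₁_of_isFiniteUnionOfIntervals (ModelTheoryPreds.lean). -/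
@[route_item "route-AnomalousDissipation-TameDichotomy"]
def OMinimalMonotonicity : Prop :=
  ∀ (L : FirstOrder.Language.{0, 0}) [L.Structure ℝ] (φ : FirstOrder.Language.LHom Literature.ModelTheory.ExponentialFields.Language.orderedRing L) [φ.IsExpansionOn ℝ], L.IsOMinimal ℝ → ∀ g : ℝ → ℝ, (Set.univ : Set ℝ).Definable L {v : Fin 2 → ℝ | v 1 = g (v 0)} → ∃ δ : ℝ, 0 < δ ∧ ContinuousOn g (Set.Ioo 0 δ) ∧ (MonotoneOn g (Set.Ioo 0 δ) ∨ AntitoneOn g (Set.Ioo 0 δ))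

/-- item stmt-AnomalousDissipation-2854 · support · rank 9 · open · by planner
sources: Dries1998, DoeringFoias2002, FoiasManleyRosaTemam2001
[support] TAME LIMIT + POWER IDENTITY (first rung of NoTameCascade; new but routine given
OMinimalMonotonicity). Same hypotheses as NoTameCascade ⇒ ∃ ū : T³ → E³ with u_ν(x) → ū(x) as ν → 0⁺
for a.e. x (in fact every x, limit possibly infinite on a null definable set), ∫‖ū‖² < ∞, and
ν·gradNormSq(u_ν) → ∫ ⟪f,ū⟫. Proof plan (~300 lines): (1) for fixed x and i the fibre ν ↦ (u_ν x)_i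
is L-definable with parameters (a fibre of the definable graph; parameters x ∈ cube) ⇒ eventually
monotone (OMinimalMonotonicity) ⇒ has a limit in EReal; (2) Fatou with ∫|u_ν|² ≤ E ⇒ finite a.e. and
ū ∈ L²; (3) steady energy identity ν‖∇u_ν‖² = ∫⟪f,u_ν⟫ (multiply the steady equation by u_ν:
⟪convect u u, u⟫ and ⟪∇p,u⟫ integrate to 0 on T³, ⟪Δu,u⟫ = −gradNormSq; cf. named fact
Torus.IsClassicalNSSolutionOn.energy_balance for the time-dependent form, may be taken as hypothesis
if not yet discharged); (4) ⟪f,u_ν⟫ → ⟪f,ū⟫ in L¹ by Vitali (f bounded, (u_ν) bounded in L² on a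
probability space ⇒ uniformly integrable; sequences ν_n → 0⁺ suffice for nhdsWithin). Sources:
Dries1998 Ch.3 (1.2) PDF p.60; DoeringFoias2002 §2 (energy identity); FMRT2001 Ch. II. -/
@[route_item "route-AnomalousDissipation-TameDichotomy"]
def TameLimitPower : Prop :=
  ∀ (L : FirstOrder.Language.{0, 0}) [L.Structure ℝ] (φ : FirstOrder.Language.LHom Literature.ModelTheory.ExponentialFields.Language.orderedRing L) [φ.IsExpansionOn ℝ], L.IsOMinimal ℝ → ∀ f : UnitAddTorus (Fin 3) → EuclideanSpace ℝ (Fin 3), Literature.Analysis.FunctionSpaces.Torus.IsSmooth f → Literature.Analysis.FunctionSpaces.Torus.IsDivFree f → Literature.Analysis.FunctionSpaces.Torus.HasZeroMean f → ∀ (δ : ℝ) (u : ℝ → UnitAddTorus (Fin 3) → EuclideanSpace ℝ (Fin 3)) (p : ℝ → UnitAddTorus (Fin 3) → ℝ), 0 < δ → (Set.univ : Set ℝ).Definable L {v : Fin 7 → ℝ | v 0 ∈ Set.Ioo 0 δ ∧ v 1 ∈ Set.Ico (0 : ℝ) 1 ∧ v 2 ∈ Set.Ico (0 : ℝ) 1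 ∧ v 3 ∈ Set.Ico (0 : ℝ) 1 ∧ v 4 = u (v 0) (Literature.Analysis.FunctionSpaces.Torus.proj !₂[v 1, v 2, v 3]) 0 ∧ v 5 = u (v 0) (Literature.Analysis.FunctionSpaces.Torus.proj !₂[v 1, v 2, v 3]) 1 ∧ v 6 = u (v 0) (Literature.Analysis.FunctionSpaces.Torus.proj !₂[v 1, v 2, v 3]) 2} → (∀ ν ∈ Set.Ioo 0 δ, Literature.Analysis.FunctionSpaces.Torus.IsClassicalNSSolutionOn Set.univ ν (fun _ => f) (fun _ => u ν) (fun _ => p ν)) → (∃ E : ℝ, ∀ ν ∈ Set.Ioo 0 δ, ∫ x, ‖u ν x‖ ^ 2 ≤ E) → ∃ ū : UnitAddTorus (Fin 3) → EuclideanSpace ℝ (Fin 3), (∀ᵐ x, Filter.Tendsto (fun ν => u ν x) (nhdsWithin 0 (Set.Ioi 0)) (nhds (ū x))) ∧ MeasureTheory.Integrable (fun x => ‖ū x‖ ^ 2) ∧ Filter.Tendsto (fun ν => ν * Literature.Analysis.FunctionSpaces.Torus.gradNormSq (u ν)) (nhdsWithin 0 (Set.Ioi 0)) (nhds (∫ x,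 inner ℝ (f x) (ū x)))

/-- item stmt-AnomalousDissipation-2856 · support · rank 11 · open · by planner
sources: Dries1998
[support] UNIFORM FINITENESS for definable families of subsets of the line (input (F); KNOWN: van
den Dries Ch.3 Lemma (2.13) PDF p.67 'Y definable, finite over R^m ⇒ uniformly finite', and Cor.
(3.6)/(3.7) PDF p.76: fibres S_a of a definable S ⊆ R^m × R^n have ≤ M_S cells). Filed in
fibre-over-ℝ form: for L-definable S ⊆ ℝ^{n+1} there is N with every fibre {t : Fin.snoc a t ∈ S}
having at most N frontier points (so ≤ N+1 intervals/points). Needs the cell decomposition theorem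
(2.11) in dimension n+1 — a substantial but classical formalisation (~1500 lines), independent of
fluids; provers idle on the PDE side may take it. The torus-side uses: number of cells of {x :
|∇u_ν(x)| > ν^{-a}} ∩ (coordinate lines), of monotonicity intervals of u_ν along lines, of strata of
the limit ū — all bounded uniformly in ν. -/
@[route_item "route-AnomalousDissipation-TameDichotomy"]
def OMinimalUniformFiniteness : Prop :=
  ∀ (L : FirstOrder.Language.{0, 0}) [L.Structure ℝ] (φ : FirstOrder.Language.LHom Literature.ModelTheory.ExponentialFields.Language.orderedRing L) [φ.IsExpansionOn ℝ], L.IsOMinimal ℝ → ∀ (n : ℕ) (S : Set (Fin (n + 1) → ℝ)), (Set.univ : Set ℝ).Definable L S → ∃ N : ℕ, ∀ (a : Fin n → ℝ) (F : Finset ℝ), (↑F ⊆ frontier {t : ℝ | Fin.snoc a t ∈ S}) → F.card ≤ N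

/-- item stmt-AnomalousDissipation-14270 · support · rank 12 · open · by planner
sources: Dries1998, DoeringFoias2002
[support] FORK GLUE — makes the target TameSteadyWitness reachable from the cruxes (route-choice
repair 2026-08-16, hold `target-unreachable`): TameCascade → TameLimitPower → TameSteadyWitness.
PROVABLE NOW, ~35 lines, certified by the planner (Sketch.lean `tameForkGlue_proof`, lean check rc
0, attached as evidence on this item — copy into Theorems/TameForkGlue.lean): from TameCascade take
(f, L, φ, δ, u, p, E) and the non-convergence h¬; TameLimitPower (same hypotheses) gives Tendsto (ν
↦ ν·gradNormSq (u ν)) (𝓝[>] 0) (𝓝 l), l = ∫⟪f,ū⟫; l ≠ 0 (else h¬ fails), 0 ≤ l (ge_of_tendsto with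
Torus.gradNormSq_nonneg) ⇒ 0 < l ⇒ ∀ᶠ ν in 𝓝[>] 0, l/2 < ν·gradNormSq (u ν) (Tendsto.eventually,
lt_mem_nhds) ⇒ on some (0,δ₁) (mem_nhdsGT_iff_exists_Ioo_subset); take δ′ = min δ δ₁ and ε = l/2;
steadiness and the energy bound restrict from (0,δ) to (0,δ′); the graph over (0,δ′) is the old
graph ∩ {v | v 0 < δ′}, definable by Set.Definable.inter and definable_setOf_lt
(definable_lt_of_expansion φ) (definableFun_proj 0) (definableFun_const' _ δ′) from
Literature/ModelTheory/ExponentialFields/OMinimalMonotonicityReal.lean + OMinimalDefinability.lean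
(extra imports of the PROOF only; the statement needs -/
@[route_item "route-AnomalousDissipation-TameDichotomy"]
def TameForkGlue : Prop :=
  TameCascade → TameLimitPower → TameSteadyWitness

-- earlier Assembly (stmt-AnomalousDissipation-2857, replaced 2026-08-15T16:15:14Z -> stmt-AnomalousDissipation-10434): retired by None — Literature.Analysis.FluidPDE.Torus.isGlobalLerayHopf_of_isClassicalNSSolutionOn → TameSteadyWitness → AnomalousDissipation
/-- item stmt-AnomalousDissipation-10434 · assembly · rank 1 · open · by planner
sources: RobinsonRodrigoSadowski2016, Galdi2000, DoeringFoias2002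
[assembly] TameSteadyWitness → AnomalousDissipation — exactly the deciding theorem `closes` (rev 2,
native audit ok): sample ν_j := δ/(j+2) ∈ (0,δ); the time-constant classical solutions t ↦ u ν_j are
global Leray–Hopf from u ν_j by the DISCHARGED fact
Torus.isGlobalLerayHopf_of_isClassicalNSSolutionOn_holds (TorusClassicalLerayHopfProofs; used inside
the proof, not assumed); meanEnergy of a time-constant field = ∫‖u‖² and meanDissipation =
ν·gradNormSq (longTimeAvgSup of a constant; Torus.gradNormSq_eq_toReal_eGradNormSq_holds). Provable
now in one line: `fun hX => closes hX`. Sources: RobinsonRodrigoSadowski2016 Thm 6.5;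
DoeringFoias2002 §2. -/
@[route_item "route-AnomalousDissipation-TameDichotomy"]
def Assembly : Prop :=
  TameSteadyWitness → AnomalousDissipation

/-! D-0027 §2.1 — DECIDING THEOREM (planner-authored via `route open/edit --closes-file`; by planner-rbadge-AnomalousDissipation-TameDichot-f595e682-g2-0 2026-08-15T16:14:23Z):
its hypotheses are this route's items and its conclusion the sub-problem Statement (glue_lint), and it elaborates with this file. -/

@[closes "route-AnomalousDissipation-TameDichotomy"] theorem closes (hX : TameSteadyWitness) : _root_.AnomalousDissipation := by
  obtain ⟨f, hf, hdiv, hmean, L, _, φ, _, _, δ, u, p, hδ, _, hsol, ⟨E, hE⟩, ε, hε, hεle⟩ := hX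
  -- sample the definable steady family at `ν_j := δ / (j + 2) ∈ (0, δ)`; the o-minimal data are discarded
  have hmem : ∀ j : ℕ, δ / ((j : ℝ) + 2) ∈ Set.Ioo 0 δ := fun j =>
    ⟨div_pos hδ (by positivity), div_lt_self hδ (lt_add_of_nonneg_of_lt (Nat.cast_nonneg j) one_lt_two)⟩
  -- the long-time (limsup-Cesàro) mean of a time-constant signal is the constant
  have hconst : ∀ c : ℝ, Literature.Analysis.FluidPDE.longTimeAvgSup (fun _ : ℝ => c) = c := by
    intro c
    have h : Filter.Tendsto (Literature.Analysis.FluidPDE.timeMean (fun _ : ℝ => c)) Filter.atTop (nhds c) := by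
      apply tendsto_const_nhds.congr'
      filter_upwards [Filter.eventually_gt_atTop (0 : ℝ)] with T hT
      simp only [Literature.Analysis.FluidPDE.timeMean, intervalIntegral.integral_const, sub_zero, smul_eq_mul]
      rw [← mul_assoc, inv_mul_cancel₀ hT.ne', one_mul]
    exact h.limsup_eq
  refine ⟨f, hf, hdiv, hmean, fun j => δ / ((j : ℝ) + 2), fun j => u (δ / ((j : ℝ) + 2)),
    fun j _ => u (δ / ((j : ℝ) + 2)), fun j => (hmem j).1, ?_, ?_, ?_, ?_⟩
  · -- `ν_j → 0`
    exact tendsto_const_nhds.div_atTop (Filter.tendsto_atTop_add_const_right _ _ tendsto_natCast_atTop_atTop)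
  · -- a global classical (time-constant) solution is a global Leray–Hopf solution from its time-zero slice:
    -- the DISCHARGED bridge fact `Torus.isGlobalLerayHopf_of_isClassicalNSSolutionOn` (`…_holds`,
    -- Robinson–Rodrigo–Sadowski 2016 Thm. 6.5), used inside the proof, not assumed
    intro j
    exact (hsol _ (hmem j)).isGlobalLerayHopf
  · -- mean energy of a time-constant field is `∫ ‖u‖²`
    refine ⟨E, fun j => ?_⟩
    rw [Literature.Analysis.FluidPDE.meanEnergy_eq_longTimeAvgSup, hconst]
    exact hE _ (hmem j)
  · -- mean dissipation of a time-constant smooth field is `ν ‖∇u‖₂²` (spectral = classical gradient norm,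
    -- the DISCHARGED fact `Torus.gradNormSq_eq_toReal_eGradNormSq_holds`)
    refine ⟨ε, hε, fun j => ?_⟩
    unfold Literature.Analysis.FluidPDE.meanDissipation
    rw [hconst, ← Literature.Analysis.FunctionSpaces.Torus.gradNormSq_eq_toReal_eGradNormSq_holds
      ((hsol _ (hmem j)).smooth_velocity.isSmooth_slice (Set.mem_univ (0 : ℝ)))]
    exact hεle _ (hmem j)

end Summit.AnomalousDissipation.AnomalousDissipation.Theses.TameDichotomy
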